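import Summits.CriticalPhenomena.PercolationContinuityZ3.Theorems.PercNearOneGluingNoHeavyLowerTailAntitheticCycleStairSum
import Summits.CriticalPhenomena.PercolationContinuityZ3.Theorems.PercNearOneGluingNoHeavyLowerTailAntitheticCycleContractSum
import Summits.CriticalPhenomena.PercolationContinuityZ3.Theorems.PercNearOneGluingNoHeavyLowerTailAntitheticULeaf
import Summits.CriticalPhenomena.PercolationContinuityZ3.Theorems.PercNearOneGluingNoHeavyLowerTailAntitheticHarris
import HarnessLib

/-!
# `NoHeavyLowerTail` (stmt-CriticalPhenomena-4575) — antithetic cluster pairs: THEOREM C — bicluster avoidance on EVERY CYCLE, every source,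
# every avoidance set `R` (file C4; prim-hp-2 gen 40, HOME/THEOREM-C-cycles.md)

Support file (`--supports stmt-CriticalPhenomena-4575`, hull-port prover `prim-hp-2`, gen 40).  No definitions, no named facts, no sorries; standard
axioms.

THEOREM C (`Antithetic.cycle_bic_nonneg`).  Let `E` be the edge set of a cycle `v 0 = s, v 1, …, v (n−1), v n = v 0` (`n ≥ 3`, the `v i` pairwise
distinct) on a finite vertex type, `R` ANY set of vertices, `F, G` increasing functions of the edge cluster.  Then
`BIC_E(R) = Σ_{ω : no r ∈ R joined to s in both ω ∩ E and ωᶜ ∩ E} (F(C_s(ω∩E)) − F(C_s(ωᶜ∩E)))·(G(C_s(ω∩E)) − G(C_s(ωᶜ∩E))) ≥ 0`.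
With the cut-vertex theorem (…BlockGluing) this settles CONJECTURE BIC on every graph all of whose blocks are cycles, single edges, or blocks of
the other machine-checked classes.

PROOF (induction on `n`, HOME/THEOREM-C-cycles.md "LEAN BLUEPRINT").  `s ∈ R`: the sum is empty-valued (`Peel.tsum_eq_zero_of_mem_R`).  No vertex
`v a` (`0 < a < n`) in `R`: no colouring is constrained (a vertex joined to `s` lies on the cycle, `Cyc.reach_iff`) and the sum is antithetic Harris
(`antithetic_harris`).  Otherwise fix `v a ∈ R`: the constrained colourings that CHANGE colour at `v a` are exactly the staircase family
(`Cyc.tset_filter_change_eq`, via `Cyc.both_iff`: doubly reached ⟺ one-change), whose sum is `≥ 0` by THE STAIRCASE LEMMA `Cyc.stairFam_sum_nonneg`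
(…CycleStairSum); the constrained colourings WITHOUT a change at `v a` contribute half the constrained sum of the contracted cycle for the pulled
back (still increasing) functions (`Cyc.contract_sum_eq`, …CycleContractSum), `≥ 0` by induction.  Base `n = 3`: the triangle is a cone with apex
`s` (`coneLeaf_bic_nonneg`, THEOREM I′).
* `Cyc.tset_eq_univ_of_free`, `Cyc.tset_filter_change_eq` — the two descriptions of the constraint set used above;
* `Cyc.base_three` — the triangle;
* `Cyc.cycle_good` — `∀ F G increasing, 0 ≤ T_E(R,∅)` in the `Peel.tsum` vocabulary (the shape consumed by `Antithetic.Glue.tsum_union_nonneg`);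
* `Antithetic.cycle_bic_nonneg` — THEOREM C written out.
[cite: VandenbergHaggstromKahn2005, §1 p. 6 ("Harris' inequality"), §1 p. 3 (open cluster `C_s`)]
-/

noncomputable section

namespace Summit.CriticalPhenomena.PercolationContinuityZ3.Theorems

open Literature.Probability.Percolation
open scoped Classical symmDiff

namespace Antithetic

namespace Cyc

variable {V : Type*} [Fintype V]

section Split

variable {n : ℕ} {v : ℕ → V} (hn : 3 ≤ n) (hinj : ∀ i j, i < n → j < n → v i = v j → i = j) (hper : v n = v 0)
include hn hinj hper

omit [Fintype V] in
/-- A vertex joined to `s` along the cycle is a cycle vertex `v b`, `b ≤ n`. -/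
theorem exists_idx_of_reach (ω : Set (Sym2 V)) {r : V} (hr : (openGraph (ω ∩ edgeSet n v)).Reachable (v 0) r) : ∃ b, b ≤ n ∧ r = v b := by
  obtain ⟨j, ⟨hj, rfl⟩ | ⟨-, rfl⟩⟩ := (reach_iff ω hn hinj hper r).1 hr
  · exact ⟨j, hj.trans (pre_le ω), rfl⟩
  · exact ⟨n - j, Nat.sub_le _ _, rfl⟩

/-- **No forbidden position**: if neither `s` nor any other cycle vertex lies in `R`, no colouring is constrained. [this work] -/
theorem tset_eq_univ_of_free {R : Set V} (hRs : v 0 ∉ R) (hfree : ∀ b, 0 < b → b < n → v b ∉ R) :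
    Peel.tset (edgeSet n v) (v 0) R ∅ = Finset.univ := by
  rw [Finset.eq_univ_iff_forall]
  intro ω
  rw [Peel.mem_tset]
  refine ⟨fun r hr hboth => ?_, fun x hx => absurd hx (Set.notMem_empty x)⟩
  obtain ⟨b, hbn, rfl⟩ := exists_idx_of_reach hn hinj hper ω hboth.1
  by_cases hb0 : b = 0
  · subst hb0; exact hRs hr
  by_cases hbn' : b = n
  · subst hbn'; rw [hper] at hr; exact hRs hr
  exact hfree b (Nat.pos_of_ne_zero hb0) (lt_of_le_of_ne hbn hbn') hr

/-- **A forbidden position**: if `v a ∈ R ∌ s` (`0 < a < n`), the constrained colourings that change colour at `v a` are exactly the staircase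
family at `a` (change at `v a`, legs not both monochromatic). [this work] -/
theorem tset_filter_change_eq {a : ℕ} (ha0 : 0 < a) (han : a < n) {R : Set V} (hRs : v 0 ∉ R) (haR : v a ∈ R) :
    (Peel.tset (edgeSet n v) (v 0) R ∅).filter (fun ω => ¬ (edge v (a - 1) ∈ ω ↔ edge v a ∈ ω)) = stairFam n v a := by
  ext ω
  rw [Finset.mem_filter, Peel.mem_tset, stairFam, Finset.mem_filter]
  constructor
  · rintro ⟨⟨hR, -⟩, hchg⟩
    refine ⟨Finset.mem_univ _, hchg, fun hmono => hR (v a) haR ?_⟩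
    obtain ⟨hu, hw⟩ := hmono
    rw [both_iff ω hn hinj hper ha0 han]
    have hua : edge v (a - 1) ∈ ω ↔ edge v 0 ∈ ω := hu (a - 1) (by omega)
    have hwa : edge v a ∈ ω ↔ edge v (n - 1) ∈ ω := hw a le_rfl han
    by_cases h0 : edge v 0 ∈ ω
    · have ha' : edge v a ∉ ω := fun h => hchg (iff_of_true (hua.2 h0) h)
      exact Or.inl ⟨fun i hi => (hu i hi).2 h0, fun i hai hin h => ha' (hwa.2 ((hw i hai hin).1 h))⟩
    · have ha' : edge v a ∈ ω := by
        by_contra h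
        exact hchg (iff_of_false (fun h' => h0 (hua.1 h')) h)
      exact Or.inr ⟨fun i hi h => h0 ((hu i hi).1 h), fun i hai hin => (hw i hai hin).2 (hwa.1 ha')⟩
  · rintro ⟨-, hchg, hnm⟩
    refine ⟨⟨fun r hr hboth => ?_, fun x hx => absurd hx (Set.notMem_empty x)⟩, hchg⟩
    obtain ⟨b, hbn, rfl⟩ := exists_idx_of_reach hn hinj hper ω hboth.1
    by_cases hb0 : b = 0
    · subst hb0; exact hRs hr
    by_cases hbn' : b = n
    · subst hbn'; rw [hper] at hr; exact hRs hr
    have hb0' : 0 < b := Nat.pos_of_ne_zero hb0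
    have hbn'' : b < n := lt_of_le_of_ne hbn hbn'
    rcases (both_iff ω hn hinj hper hb0' hbn'').1 hboth with ⟨h1, h2⟩ | ⟨h1, h2⟩
    · by_cases hba : b = a
      · subst hba
        exact hnm ⟨fun i hi => iff_of_true (h1 i hi) (h1 0 hb0'),
          fun i hai hin => iff_of_false (h2 i hai hin) (h2 (n - 1) (by omega) (by omega))⟩
      · apply hchg
        by_cases hlt : a < b
        · exact iff_of_true (h1 _ (by omega)) (h1 _ hlt)
        · exact iff_of_false (h2 _ (by omega) (by omega)) (h2 _ (by omega) han)
    · by_cases hba : b = a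
      · subst hba
        exact hnm ⟨fun i hi => iff_of_false (h1 i hi) (h1 0 hb0'),
          fun i hai hin => iff_of_true (h2 i hai hin) (h2 (n - 1) (by omega) (by omega))⟩
      · apply hchg
        by_cases hlt : a < b
        · exact iff_of_false (h1 _ (by omega)) (h1 _ hlt)
        · exact iff_of_true (h2 _ (by omega) (by omega)) (h2 _ (by omega) han)

end Split

section Base

/-- **The triangle** (`n = 3`): its apex `s = v 0` is adjacent to both other vertices, so THEOREM I′ applies. [this work] -/
theorem base_three {v : ℕ → V} (hper : v 3 = v 0) (R : Set V) {F G : Set (Sym2 V) → ℝ} (hF : Monotone F) (hG : Monotone G) :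
    0 ≤ Peel.tsum F G (edgeSet 3 v) (v 0) R ∅ := by
  rw [Pendant.tsum_empty_eq]
  refine coneLeaf_bic_nonneg (edgeSet 3 v) (v 0) (fun w x y hw _ _ _ hwx _ => ?_) R hF hG
  obtain ⟨i, hi, he⟩ := hwx
  have hw' : w ∈ edge v i := by rw [← he]; exact Sym2.mem_mk_left _ _
  have h01 : s(v 0, v 1) ∈ edgeSet 3 v := ⟨0, by omega, rfl⟩
  have h02 : s(v 0, v 2) ∈ edgeSet 3 v := ⟨2, by omega, by rw [edge, show (2 : ℕ) + 1 = 3 from rfl, hper, Sym2.eq_swap]⟩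
  unfold edge at hw'
  rcases Sym2.mem_iff.1 hw' with rfl | rfl
  · interval_cases i
    · exact absurd rfl hw
    · exact h01
    · exact h02
  · interval_cases i
    · exact h01
    · exact h02
    · exact absurd hper hw

end Base

section Main

/-- **THEOREM C in the `Peel.tsum` vocabulary, by induction on the length of the cycle** (statement quantified for the induction). [this work] -/
theorem cycle_tsum_nonneg_aux : ∀ n : ℕ, 3 ≤ n → ∀ v : ℕ → V, (∀ i j, i < n → j < n → v i = v j → i = j) → v n = v 0 →
    ∀ (R : Set V) (F G : Set (Sym2 V) → ℝ), Monotone F → Monotone G → 0 ≤ Peel.tsum F G (edgeSet n v) (v 0) R ∅ := by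
  intro n hn
  induction n, hn using Nat.le_induction with
  | base => exact fun v _ hper R F G hF hG => base_three hper R hF hG
  | succ n hn ih =>
    intro v hinj hper R F G hF hG
    by_cases hRs : v 0 ∈ R
    · exact (Peel.tsum_eq_zero_of_mem_R F G _ (v 0) ∅ hRs).ge
    by_cases hfree : ∀ b, 0 < b → b < n + 1 → v b ∉ R
    · rw [Peel.tsum, tset_eq_univ_of_free (by omega) hinj hper hRs hfree]
      exact antithetic_harris (edgeSet (n + 1) v) (v 0) hF hG
    push Not at hfree
    obtain ⟨a, ha0, han, haR⟩ := hfree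
    rw [Peel.tsum, ← Finset.sum_filter_add_sum_filter_not _ (fun ω => ¬ (edge v (a - 1) ∈ ω ↔ edge v a ∈ ω)),
      tset_filter_change_eq (by omega) hinj hper ha0 han hRs haR]
    have htied : (Peel.tset (edgeSet (n + 1) v) (v 0) R ∅).filter (fun ω => ¬ ¬ (edge v (a - 1) ∈ ω ↔ edge v a ∈ ω)) =
        (Peel.tset (edgeSet (n + 1) v) (v 0) R ∅).filter (fun ω => (edge v (a - 1) ∈ ω ↔ edge v a ∈ ω)) :=
      Finset.filter_congr fun ω _ => not_not
    rw [htied]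
    have key := contract_sum_eq hn hinj hper (by omega : 1 ≤ a) (by omega : a ≤ n) F G R
    have ih' := ih (skip v a) (skip_inj hinj) (skip_per hper (by omega) (by omega)) R (F ∘ expand v a) (G ∘ expand v a)
      (hF.comp expand_mono) (hG.comp expand_mono)
    rw [skip_lt ha0, ← key] at ih'
    have hst := stairFam_sum_nonneg (by omega : 3 ≤ n + 1) hinj hper ha0 han hF hG
    linarith

/-- **THEOREM C, `good` form**: the edge set of a cycle through `s` is good for every `R` (no sinks) — `0 ≤ T_E(R,∅)` for all increasing `F, G` —
the shape consumed by the cut-vertex theorem `Antithetic.Glue.tsum_union_nonneg` and the pendant lemmas. [this work] -/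
theorem cycle_good {n : ℕ} (hn : 3 ≤ n) {v : ℕ → V} (hinj : ∀ i j, i < n → j < n → v i = v j → i = j) (hper : v n = v 0) (R : Set V) :
    ∀ F G : Set (Sym2 V) → ℝ, Monotone F → Monotone G → 0 ≤ Peel.tsum F G (edgeSet n v) (v 0) R ∅ :=
  fun F G hF hG => cycle_tsum_nonneg_aux n hn v hinj hper R F G hF hG

end Main

end Cyc

section TheoremC

variable {V : Type*} [Fintype V]

/-- **THEOREM C (prim-hp-2 gen 39/40): BICLUSTER AVOIDANCE ON EVERY CYCLE, EVERY SOURCE, EVERY AVOIDANCE SET.**  `E = {v i v (i+1) : i < n}` the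
edge set of a cycle `v 0 = s, v 1, …, v (n−1), v n = v 0` (`n ≥ 3`, `v` injective on `[0,n)`) on a finite vertex type, `R` any set of vertices,
`F, G` increasing functions of the edge cluster.  Then
`0 ≤ Σ_{ω : no r ∈ R is joined to s both in ω ∩ E and in ωᶜ ∩ E} (F(C_s(ω∩E)) − F(C_s(ωᶜ∩E))) · (G(C_s(ω∩E)) − G(C_s(ωᶜ∩E)))`
(for `R = ∅`: antithetic Harris; the sum is TIGHT, e.g. `F = 1[⊇ arc]`, `G = 1[⊇ complementary arc]`).  Proof: module docstring. [this work] -/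
theorem cycle_bic_nonneg {n : ℕ} (hn : 3 ≤ n) (v : ℕ → V) (hinj : ∀ i j, i < n → j < n → v i = v j → i = j) (hper : v n = v 0)
    (R : Set V) {F G : Set (Sym2 V) → ℝ} (hF : Monotone F) (hG : Monotone G) :
    0 ≤ ∑ ω ∈ Finset.univ.filter (fun ω : Set (Sym2 V) =>
        ∀ r ∈ R, ¬ ((openGraph (ω ∩ Cyc.edgeSet n v)).Reachable (v 0) r ∧ (openGraph (ωᶜ ∩ Cyc.edgeSet n v)).Reachable (v 0) r)),
      (F (openEdgeCluster (ω ∩ Cyc.edgeSet n v) (v 0)) - F (openEdgeCluster (ωᶜ ∩ Cyc.edgeSet n v) (v 0))) *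
        (G (openEdgeCluster (ω ∩ Cyc.edgeSet n v) (v 0)) - G (openEdgeCluster (ωᶜ ∩ Cyc.edgeSet n v) (v 0))) := by
  rw [← Pendant.tsum_empty_eq]
  exact Cyc.cycle_tsum_nonneg_aux n hn v hinj hper R F G hF hG

end TheoremC

end Antithetic

end Summit.CriticalPhenomena.PercolationContinuityZ3.Theorems
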